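import Summits.Ventures.Crystal3D.Theorems.StickyWulffConstantCoaxialWallLawSeamMultiCoreSplit
import HarnessLib

/-!
# The MULTI-PIECE split with pairs charged to any piece they DESCEND to (crux `CoaxialWallLaw`, stmt-Ventures-19481; line `WallLedgerF`,
# skeleton 'CoaxialWallLawCertificates' v8.1, stub `stub_incoherentSeamSmall`; F-TAIL-g12 §7)

HONEST FRAMING. Venture `Summits/Ventures/Crystal3D` (cell `crystal3d-full`); a census-free comparison inequality for the crux `CoaxialWallLaw` (stmt-Ventures-19481,
`route-Ventures-StickyWulffConstant`), lane F T5b.  `…SeamMultiCoreSplit` charges a pair to a core through `IsCorePairA` (EVERY inspected ball in the core);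
'…SeamReaderPiece' shows that a straight-move pair DESCENDS to its reader's piece (`IsEndPairA (coreOf Y q G) b q`) — a weaker, sufficient relation.  This file
re-runs the split with that relation.  Nothing about the stubs is claimed; F-C1 not moved.
* `pieceMultA Y E v S₁ S₂ b` — the (A)-pairs `(b, q)` of `Y` that are ALSO (A)-pairs of `E`; `pieceMultA_le_endMultA` (`≤ e_E(b)`, trivially);
* `sum_pieceMult_div_le_coreTerm` — `Σ_{b loaded in Y near z} pieceMultA/pooledDef Y ≤ coreTerm Y E z` (lowered pools positive);
* `restPieceMultA Y 𝓔 b` — pairs of `Y` at `b` descending to NO piece of the family; `endMultA_le_sum_pieceMultA_add_rest`;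
* **`localSummandA_le_sum_coreTerms_add_restPiece`** — `Σ_A(Y, z) ≤ Σ_{E ∈ 𝓔} coreTerm Y E z + Σ_{b near z} restPieceMultA(b)/pooledDef Y b`.
With `𝓔 ∋ coreOf Y q G` for every straight-move reader `q` near `z`, the residual counts CROSS-MOVE pairs only ('…SeamReaderPiece.isEndPairA_readerPiece_of_straight').
-/

noncomputable section

namespace Summit.Ventures.Crystal3D.Theorems

namespace TailResidue

open Summit.Ventures.Crystal3D Finset
open scoped InnerProductSpace

section MultiPiece

variable {Y : Finset (EuclideanSpace ℝ (Fin 3))} {v : WordVersion} {S₁ S₂ : PlateSystem}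

variable (Y v S₁ S₂)

open scoped Classical in
/-- PIECE MULTIPLICITY: the (A)-end pairs `(b, q)` of `Y` that are also (A)-end pairs of the piece `E`. -/
def pieceMultA (E : Finset (EuclideanSpace ℝ (Fin 3))) (b : EuclideanSpace ℝ (Fin 3)) : ℕ :=
  (Y.filter fun q => IsEndPairA Y v S₁ S₂ b q ∧ IsEndPairA E v S₁ S₂ b q).card

open scoped Classical in
/-- RESIDUAL multiplicity: the (A)-end pairs of `Y` at `b` that descend to NO piece of the family `𝓔`. -/
def restPieceMultA (𝓔 : Finset (Finset (EuclideanSpace ℝ (Fin 3)))) (b : EuclideanSpace ℝ (Fin 3)) : ℕ :=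
  (Y.filter fun q => IsEndPairA Y v S₁ S₂ b q ∧ ∀ E ∈ 𝓔, ¬ IsEndPairA E v S₁ S₂ b q).card

variable {Y v S₁ S₂}

open scoped Classical in
/-- `pieceMultA ≤ e_E`. -/
theorem pieceMultA_le_endMultA (E : Finset (EuclideanSpace ℝ (Fin 3))) (b : EuclideanSpace ℝ (Fin 3)) : pieceMultA Y v S₁ S₂ E b ≤ endMultA E v S₁ S₂ b := by
  unfold pieceMultA endMultA
  refine card_le_card fun q hq => ?_
  obtain ⟨-, -, hE⟩ := mem_filter.1 hq
  exact mem_filter.2 ⟨hE.1, hE⟩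

open scoped Classical in
/-- A positive piece multiplicity puts `b` in the piece. -/
theorem mem_of_pieceMultA_pos {E : Finset (EuclideanSpace ℝ (Fin 3))} {b : EuclideanSpace ℝ (Fin 3)} (h : 0 < pieceMultA Y v S₁ S₂ E b) : b ∈ E := by
  unfold pieceMultA at h
  obtain ⟨q, hq⟩ := card_pos.1 h
  exact (mem_filter.1 hq).2.2.2.1

open scoped Classical in
/-- **The piece half of the split for one piece**: `Σ_{b loaded in Y near z} pieceMultA/pooledDef Y ≤ coreTerm Y E z`. -/
theorem sum_pieceMult_div_le_coreTerm {E : Finset (EuclideanSpace ℝ (Fin 3))} (hY : ∀ p ∈ Y, ∀ q ∈ Y, p ≠ q → 1 ≤ dist p q) (hsub : E ⊆ Y)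
    (z : EuclideanSpace ℝ (Fin 3)) (hposE : ∀ b ∈ E, dist z b ≤ 1 → 0 < endMultA E v S₁ S₂ b → 0 < loweredPool Y E b) :
    ∑ b ∈ Y.filter (fun b => dist z b ≤ 1 ∧ 0 < endMultA Y v S₁ S₂ b), (pieceMultA Y v S₁ S₂ E b : ℝ) / pooledDef Y b ≤ coreTerm Y E v S₁ S₂ z := by
  unfold coreTerm
  have hexle : ∀ b, pieceMultA Y v S₁ S₂ E b ≤ endMultA E v S₁ S₂ b := fun b => pieceMultA_le_endMultA E b
  have hpoolle : ∀ b, pooledDef E b +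
      ∑ x ∈ (Y \ E).filter (fun x => dist b x ≤ 1 ∧ (Y.filter fun q => dist x q = 1).card ≤ 11), ((12 : ℝ) - ((Y.filter fun q => dist x q = 1).card : ℝ)) ≤
      pooledDef Y b + (((E.filter fun y => dist b y ≤ 1) ×ˢ (Y \ E)).filter fun p => dist p.1 p.2 = 1).card := fun b => pooledDef_core_le hY hsub b
  set A := Y.filter (fun b => dist z b ≤ 1 ∧ 0 < endMultA Y v S₁ S₂ b) with hA
  set AE := E.filter (fun b => dist z b ≤ 1 ∧ 0 < endMultA E v S₁ S₂ b) with hAE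
  set gE : EuclideanSpace ℝ (Fin 3) → ℝ := fun b => (endMultA E v S₁ S₂ b : ℝ) / loweredPool Y E b with hgE
  set fX : EuclideanSpace ℝ (Fin 3) → ℝ := fun b => (pieceMultA Y v S₁ S₂ E b : ℝ) / pooledDef Y b with hfX
  have key : ∀ b ∈ A, (0 < pieceMultA Y v S₁ S₂ E b → b ∈ AE ∧ fX b ≤ gE b) ∧ (pieceMultA Y v S₁ S₂ E b = 0 → fX b = 0) := by
    intro b hb
    obtain ⟨hbY, hb1, hepos⟩ := mem_filter.1 hb
    refine ⟨fun hx => ?_, fun h0 => by simp only [hfX, h0, Nat.cast_zero, zero_div]⟩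
    have hbE : b ∈ E := mem_of_pieceMultA_pos hx
    have hle := hexle b
    have hp := hpoolle b
    have hDpos : 0 < loweredPool Y E b := hposE b hbE hb1 (lt_of_lt_of_le hx hle)
    have hDle : loweredPool Y E b ≤ pooledDef Y b := by unfold loweredPool; linarith
    refine ⟨mem_filter.2 ⟨hbE, hb1, lt_of_lt_of_le hx hle⟩, ?_⟩
    have hleR : (pieceMultA Y v S₁ S₂ E b : ℝ) ≤ (endMultA E v S₁ S₂ b : ℝ) := by exact_mod_cast hle
    calc fX b = (pieceMultA Y v S₁ S₂ E b : ℝ) / pooledDef Y b := rfl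
      _ ≤ (endMultA E v S₁ S₂ b : ℝ) / pooledDef Y b := div_le_div_of_nonneg_right hleR (hDpos.le.trans hDle)
      _ ≤ gE b := div_le_div_of_nonneg_left (Nat.cast_nonneg _) hDpos hDle
  have hgnn : ∀ b ∈ AE, 0 ≤ gE b := fun b hb => div_nonneg (Nat.cast_nonneg _) (hposE b (mem_filter.1 hb).1 (mem_filter.1 hb).2.1 (mem_filter.1 hb).2.2).le
  calc ∑ b ∈ A, fX b = ∑ b ∈ A.filter (fun b => 0 < pieceMultA Y v S₁ S₂ E b), fX b :=
        (sum_filter_of_ne fun b hb hne => Nat.pos_of_ne_zero fun h0 => hne ((key b hb).2 h0)).symm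
    _ ≤ ∑ b ∈ A.filter (fun b => 0 < pieceMultA Y v S₁ S₂ E b), gE b :=
        sum_le_sum fun b hb => ((key b (mem_filter.1 hb).1).1 (mem_filter.1 hb).2).2
    _ ≤ ∑ b ∈ AE, gE b :=
        sum_le_sum_of_subset_of_nonneg (fun b hb => ((key b (mem_filter.1 hb).1).1 (mem_filter.1 hb).2).1) fun b hb _ => hgnn b hb

open scoped Classical in
/-- Every (A)-pair descends to some piece of the family or is residual: `e_Y(b) ≤ Σ_{E ∈ 𝓔} pieceMultA Y E b + restPieceMultA Y 𝓔 b`. -/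
theorem endMultA_le_sum_pieceMultA_add_rest (𝓔 : Finset (Finset (EuclideanSpace ℝ (Fin 3)))) (b : EuclideanSpace ℝ (Fin 3)) :
    endMultA Y v S₁ S₂ b ≤ ∑ E ∈ 𝓔, pieceMultA Y v S₁ S₂ E b + restPieceMultA Y v S₁ S₂ 𝓔 b := by
  unfold endMultA pieceMultA restPieceMultA
  have hcover : (Y.filter fun q => IsEndPairA Y v S₁ S₂ b q) ⊆
      (𝓔.biUnion fun E => Y.filter fun q => IsEndPairA Y v S₁ S₂ b q ∧ IsEndPairA E v S₁ S₂ b q) ∪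
        (Y.filter fun q => IsEndPairA Y v S₁ S₂ b q ∧ ∀ E ∈ 𝓔, ¬ IsEndPairA E v S₁ S₂ b q) := by
    intro q hq
    obtain ⟨hqY, hp⟩ := mem_filter.1 hq
    by_cases h : ∃ E ∈ 𝓔, IsEndPairA E v S₁ S₂ b q
    · obtain ⟨E, hE, hc⟩ := h
      exact mem_union.2 (Or.inl (mem_biUnion.2 ⟨E, hE, mem_filter.2 ⟨hqY, hp, hc⟩⟩))
    · push Not at h
      exact mem_union.2 (Or.inr (mem_filter.2 ⟨hqY, hp, h⟩))
  exact (card_le_card hcover).trans ((card_union_le _ _).trans (Nat.add_le_add_right card_biUnion_le _))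

open scoped Classical in
/-- **THE MULTI-PIECE SPLIT (descent form)**: for a finite family of pieces `E ⊆ Y` whose lowered pools are positive at their loaded balls within `1` of the payer,
`Σ_A(Y, z) ≤ Σ_{E ∈ 𝓔} coreTerm Y E z + Σ_{b ∈ Y, |b − z| ≤ 1, restPieceMultA b > 0} restPieceMultA(b) / pooledDef Y b`. -/
theorem localSummandA_le_sum_coreTerms_add_restPiece (hY : ∀ p ∈ Y, ∀ q ∈ Y, p ≠ q → 1 ≤ dist p q)
    (z : EuclideanSpace ℝ (Fin 3)) (𝓔 : Finset (Finset (EuclideanSpace ℝ (Fin 3)))) (hsub : ∀ E ∈ 𝓔, E ⊆ Y)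
    (hpos : ∀ E ∈ 𝓔, ∀ b ∈ E, dist z b ≤ 1 → 0 < endMultA E v S₁ S₂ b → 0 < loweredPool Y E b) :
    localSummandA v S₁ S₂ Y z ≤ ∑ E ∈ 𝓔, coreTerm Y E v S₁ S₂ z +
      ∑ b ∈ Y.filter (fun b => dist z b ≤ 1 ∧ 0 < restPieceMultA Y v S₁ S₂ 𝓔 b), (restPieceMultA Y v S₁ S₂ 𝓔 b : ℝ) / pooledDef Y b := by
  unfold localSummandA
  set A := Y.filter (fun b => dist z b ≤ 1 ∧ 0 < endMultA Y v S₁ S₂ b) with hA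
  have hp0 : ∀ b, 0 ≤ pooledDef Y b := fun b => EndRowFloor.pooledDef_nonneg Y b
  have hterm : ∀ b ∈ A, (endMultA Y v S₁ S₂ b : ℝ) / pooledDef Y b ≤
      ∑ E ∈ 𝓔, (pieceMultA Y v S₁ S₂ E b : ℝ) / pooledDef Y b + (restPieceMultA Y v S₁ S₂ 𝓔 b : ℝ) / pooledDef Y b := by
    intro b _
    rw [← sum_div, ← add_div]
    refine div_le_div_of_nonneg_right ?_ (hp0 b)
    exact_mod_cast endMultA_le_sum_pieceMultA_add_rest 𝓔 b
  refine (sum_le_sum hterm).trans ?_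
  rw [sum_add_distrib, sum_comm]
  refine add_le_add (sum_le_sum fun E hE => sum_pieceMult_div_le_coreTerm hY (hsub E hE) z (hpos E hE)) ?_
  have hrest : ∑ b ∈ A, (restPieceMultA Y v S₁ S₂ 𝓔 b : ℝ) / pooledDef Y b =
      ∑ b ∈ A.filter (fun b => 0 < restPieceMultA Y v S₁ S₂ 𝓔 b), (restPieceMultA Y v S₁ S₂ 𝓔 b : ℝ) / pooledDef Y b :=
    (sum_filter_of_ne fun b _ hne => Nat.pos_of_ne_zero fun h0 => hne (by simp only [h0, Nat.cast_zero, zero_div])).symm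
  rw [hrest]
  refine sum_le_sum_of_subset_of_nonneg (fun b hb => ?_) fun b _ _ => div_nonneg (Nat.cast_nonneg _) (hp0 b)
  obtain ⟨hbA, hr⟩ := mem_filter.1 hb
  exact mem_filter.2 ⟨(mem_filter.1 hbA).1, (mem_filter.1 hbA).2.1, hr⟩

end MultiPiece

end TailResidue

end Summit.Ventures.Crystal3D.Theorems

end
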